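import Mathlib
import HarnessLib
import Summits.ABC.ABC.Theorems.SoloBlindTwoadicCore

/-!
# `ω = 3`, the power of `2` at the top: the KNOWN side in shapes E (`1 + 2^k = p^l q^m`) and F (`1 + p^l q^m = 2^k`)

`Summits/ABC/ABC/Theorems/SoloBlindPow2EndKnown.lean`; namespace `Summit.ABC.ABC.Theorems`
(solo seat `solo-ABC-blind`, wall coordinate C1⁗(1); companion of `SoloBlindShapeBKnown` (shape B) and
`SoloBlindTwoadicCore` (the `2`-adic core `twoadic_exponent_le`, Bugeaud–Laurent)).

* `shapeE_exponent_le`, `shapeE_log_c_le` : `1 + 2^k = p^l q^m` (`p ≠ q` odd primes, `l, m ≥ 1`) ⟹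
  `k ≤ 50000 · log p · log q`, `log c ≤ (50000 log p log q + 1) log 2`  (`k = ord₂(p^l q^m − 1)`);
* `shapeF_exponent_le`, `shapeF_log_c_le` : `1 + p^l q^m = 2^k` ⟹ `k ≤ 50000 · log p · log q`
  (`k = ord₂((−p^l)(q^m)^{-1}… − 1)`; parity: `l, m` not both even, `shapeF_not_both_even`, since a sum of
  `1` and an odd square is `2 mod 4`).

READING.  On these families `abc` asks for `log c ≤ (1 + ε)(log 2 + log p + log q) + O_ε(1)` — the SUM of
the heights; what is known is their PRODUCT with an absolute constant (no `log log`, no `N(𝔭)`).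
Trust base: the named fact `bugeaudLaurent1996_rat`, as a hypothesis; everything else is proved.
-/

noncomputable section

namespace Summit.ABC.ABC.Theorems

open Real Literature.NumberTheory.Transcendental

/-- **Shape E, known side.**  If `p ≠ q` are odd primes, `l, m ≥ 1` and `1 + 2^k = p^l q^m`, then
(granting `bugeaudLaurent1996_rat`) `k ≤ 50000 · log p · log q`: here `k = ord₂(p^l q^m − 1)`
and `p^l, q^m ≤ 2^{k+1}`. [folklore] -/
theorem shapeE_exponent_le (hBL : bugeaudLaurent1996_rat) {p q k l m : ℕ}
    (hp : p.Prime) (hq : q.Prime) (hp2 : p ≠ 2) (hq2 : q ≠ 2) (hpq : p ≠ q)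
    (hl : 0 < l) (hm : 0 < m) (h : 1 + 2 ^ k = p ^ l * q ^ m) :
    (k : ℝ) ≤ 50000 * Real.log p * Real.log q := by
  have hp3 : 3 ≤ p := by have := hp.two_le; omega
  have hq3 : 3 ≤ q := by have := hq.two_le; omega
  have hpl3 : 3 ≤ p ^ l := le_trans hp3 (Nat.le_self_pow hl.ne' p)
  have hqm3 : 3 ≤ q ^ m := le_trans hq3 (Nat.le_self_pow hm.ne' q)
  have hk0 : 0 < k := by
    rcases Nat.eq_zero_or_pos k with hk | hk
    · exfalso
      subst hk
      have : 9 ≤ p ^ l * q ^ m := by nlinarith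
      simp at h
      omega
    · exact hk
  -- sizes in ℕ: p^l, q^m ≤ 2^(k+1)
  have h2k : 1 ≤ 2 ^ k := Nat.one_le_two_pow
  have hpl : p ^ l ≤ 2 ^ (k + 1) := by
    calc p ^ l ≤ p ^ l * q ^ m := Nat.le_mul_of_pos_right _ (by positivity)
      _ = 1 + 2 ^ k := h.symm
      _ ≤ 2 ^ (k + 1) := by rw [pow_succ]; omega
  have hqm : q ^ m ≤ 2 ^ (k + 1) := by
    calc q ^ m ≤ p ^ l * q ^ m := Nat.le_mul_of_pos_left _ (by positivity)
      _ = 1 + 2 ^ k := h.symm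
      _ ≤ 2 ^ (k + 1) := by rw [pow_succ]; omega
  have hlog2 : 0 < Real.log 2 := Real.log_pos (by norm_num)
  have hk1 : (1 : ℝ) ≤ k := by exact_mod_cast hk0
  have hs₁ : |((l : ℤ) : ℝ)| * Real.log p ≤ 3 * k * Real.log 2 := by
    push_cast
    rw [Nat.abs_cast]
    have h1 : ((p : ℝ) ^ l) ≤ (2 : ℝ) ^ (k + 1) := by exact_mod_cast hpl
    have h2 := Real.log_le_log (by positivity) h1
    rw [Real.log_pow, Real.log_pow] at h2
    push_cast at h2
    nlinarith
  have hs₂ : |((m : ℤ) : ℝ)| * Real.log q ≤ 3 * k * Real.log 2 := by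
    push_cast
    rw [Nat.abs_cast]
    have h1 : ((q : ℝ) ^ m) ≤ (2 : ℝ) ^ (k + 1) := by exact_mod_cast hqm
    have h2 := Real.log_le_log (by positivity) h1
    rw [Real.log_pow, Real.log_pow] at h2
    push_cast at h2
    nlinarith
  -- the valuation: ord₂(p^l q^m − 1) = k
  have hLHS : padicValRat 2 (((p : ℤ) : ℚ) ^ (l : ℤ) * ((q : ℤ) : ℚ) ^ (m : ℤ) - 1) = k := by
    push_cast
    rw [zpow_natCast, zpow_natCast]
    have hcast : (p : ℚ) ^ l * (q : ℚ) ^ m - 1 = (2 : ℚ) ^ k := by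
      have : (1 : ℚ) + 2 ^ k = (p : ℚ) ^ l * (q : ℚ) ^ m := by exact_mod_cast h
      linarith
    haveI : Fact (Nat.Prime 2) := ⟨Nat.prime_two⟩
    rw [hcast, padicValRat.pow]
    have h2 : padicValRat 2 (2 : ℚ) = 1 := by
      have := padicValRat.self (p := 2) (by norm_num)
      exact_mod_cast this
    rw [h2]; ring
  have hv : (k : ℝ) ≤ padicValRat 2 (((p : ℤ) : ℚ) ^ (l : ℤ) * ((q : ℤ) : ℚ) ^ (m : ℤ) - 1) := by
    rw [hLHS]; push_cast; exact le_rfl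
  exact twoadic_exponent_le hBL hp hq hp2 hq2 hpq (Or.inl rfl) (Or.inl rfl)
    (by exact_mod_cast hl.ne') (by exact_mod_cast hm.ne') hk0 hv hs₁ hs₂

/-- Shape E, the bound for `c = p^l q^m = 2^k + 1` itself:
`log c ≤ (50000 · log p · log q + 1) · log 2`. [folklore] -/
theorem shapeE_log_c_le (hBL : bugeaudLaurent1996_rat) {p q k l m : ℕ}
    (hp : p.Prime) (hq : q.Prime) (hp2 : p ≠ 2) (hq2 : q ≠ 2) (hpq : p ≠ q)
    (hl : 0 < l) (hm : 0 < m) (h : 1 + 2 ^ k = p ^ l * q ^ m) :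
    Real.log ((p : ℝ) ^ l * (q : ℝ) ^ m) ≤ (50000 * Real.log p * Real.log q + 1) * Real.log 2 := by
  have hk := shapeE_exponent_le hBL hp hq hp2 hq2 hpq hl hm h
  have hlog2 : 0 < Real.log 2 := Real.log_pos (by norm_num)
  have h2k : 1 ≤ 2 ^ k := Nat.one_le_two_pow
  have hc : p ^ l * q ^ m ≤ 2 ^ (k + 1) := by rw [← h, pow_succ]; omega
  have h1 : ((p : ℝ) ^ l * (q : ℝ) ^ m) ≤ (2 : ℝ) ^ (k + 1) := by exact_mod_cast hc
  have hpos : (0 : ℝ) < (p : ℝ) ^ l * (q : ℝ) ^ m := by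
    have : 0 < p := hp.pos
    have : 0 < q := hq.pos
    positivity
  have h2 := Real.log_le_log hpos h1
  rw [Real.log_pow] at h2
  push_cast at h2
  nlinarith

/-- On `1 + p^l q^m = 2^k` with `p, q` odd, `p ≥ 3` and `l ≥ 1`, the exponents `l, m` are not both
even (else `p^l q^m ≡ 1 (mod 4)` and `2^k ≡ 2 (mod 4)`, so `k = 1`). [folklore] -/
theorem shapeF_not_both_even {p q k l m : ℕ} (hp : Odd p) (hq : Odd q) (hp3 : 3 ≤ p)
    (hl : 0 < l) (h : 1 + p ^ l * q ^ m = 2 ^ k) : Odd l ∨ Odd m := by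
  by_contra hcon
  push Not at hcon
  obtain ⟨hle, hme⟩ := hcon
  rw [Nat.not_odd_iff_even] at hle hme
  obtain ⟨i, hi⟩ := hle
  obtain ⟨j, hj⟩ := hme
  have h1 : p ^ l % 4 = 1 := by
    rw [hi, ← two_mul, pow_mul]
    obtain ⟨r, hr⟩ := hp
    have : p ^ 2 % 4 = 1 := by
      rw [hr]; ring_nf
      omega
    rw [Nat.pow_mod, this]; simp
  have h2 : q ^ m % 4 = 1 := by
    rw [hj, ← two_mul, pow_mul]
    obtain ⟨r, hr⟩ := hq
    have : q ^ 2 % 4 = 1 := by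
      rw [hr]; ring_nf
      omega
    rw [Nat.pow_mod, this]; simp
  have h3 : (p ^ l * q ^ m) % 4 = 1 := by
    rw [Nat.mul_mod, h1, h2]
  have h4 : 2 ^ k % 4 = 2 := by omega
  -- hence k = 1, contradicting p^l q^m ≥ 3
  have hk : k = 1 := by
    rcases Nat.lt_or_ge k 2 with hk | hk
    · interval_cases k
      · simp at h4
      · rfl
    · exfalso
      obtain ⟨t, ht⟩ := Nat.exists_eq_add_of_le hk
      rw [ht, pow_add] at h4
      omega
  subst hk
  have hpl3 : 3 ≤ p ^ l := le_trans hp3 (Nat.le_self_pow hl.ne' p)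
  have hqm1 : 1 ≤ q ^ m := Nat.one_le_pow _ _ hq.pos
  have : 3 ≤ p ^ l * q ^ m := by nlinarith
  omega

/-- **Shape F, known side (case `l` odd).**  If `p ≠ q` are odd primes, `l` odd, `m ≥ 1` and
`1 + p^l q^m = 2^k`, then (granting `bugeaudLaurent1996_rat`) `k ≤ 50000 · log p · log q`:
here `k = ord₂((−p)^l q^m − 1)`. [folklore] -/
theorem shapeF_exponent_le_of_odd (hBL : bugeaudLaurent1996_rat) {p q k l m : ℕ}
    (hp : p.Prime) (hq : q.Prime) (hp2 : p ≠ 2) (hq2 : q ≠ 2) (hpq : p ≠ q)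
    (hl : Odd l) (hm : 0 < m) (h : 1 + p ^ l * q ^ m = 2 ^ k) :
    (k : ℝ) ≤ 50000 * Real.log p * Real.log q := by
  have hl0 : 0 < l := hl.pos
  have hp3 : 3 ≤ p := by have := hp.two_le; omega
  have hq3 : 3 ≤ q := by have := hq.two_le; omega
  have hpl3 : 3 ≤ p ^ l := le_trans hp3 (Nat.le_self_pow hl0.ne' p)
  have hqm3 : 3 ≤ q ^ m := le_trans hq3 (Nat.le_self_pow hm.ne' q)
  have hk0 : 0 < k := by
    rcases Nat.eq_zero_or_pos k with hk | hk
    · exfalso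
      subst hk
      have : 9 ≤ p ^ l * q ^ m := by nlinarith
      simp at h
      omega
    · exact hk
  -- sizes in ℕ: p^l, q^m ≤ 2^k
  have hpl : p ^ l ≤ 2 ^ k := by
    calc p ^ l ≤ p ^ l * q ^ m := Nat.le_mul_of_pos_right _ (by positivity)
      _ ≤ 2 ^ k := by omega
  have hqm : q ^ m ≤ 2 ^ k := by
    calc q ^ m ≤ p ^ l * q ^ m := Nat.le_mul_of_pos_left _ (by positivity)
      _ ≤ 2 ^ k := by omega
  have hlog2 : 0 < Real.log 2 := Real.log_pos (by norm_num)
  have hk1 : (1 : ℝ) ≤ k := by exact_mod_cast hk0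
  have hP0 : 0 ≤ Real.log p := Real.log_nonneg (by exact_mod_cast hp.one_lt.le)
  have hQ0 : 0 ≤ Real.log q := Real.log_nonneg (by exact_mod_cast hq.one_lt.le)
  have hs₁ : |((l : ℤ) : ℝ)| * Real.log p ≤ 3 * k * Real.log 2 := by
    push_cast
    rw [Nat.abs_cast]
    have h1 : ((p : ℝ) ^ l) ≤ (2 : ℝ) ^ k := by exact_mod_cast hpl
    have h2 := Real.log_le_log (by positivity) h1
    rw [Real.log_pow, Real.log_pow] at h2
    nlinarith
  have hs₂ : |((m : ℤ) : ℝ)| * Real.log q ≤ 3 * k * Real.log 2 := by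
    push_cast
    rw [Nat.abs_cast]
    have h1 : ((q : ℝ) ^ m) ≤ (2 : ℝ) ^ k := by exact_mod_cast hqm
    have h2 := Real.log_le_log (by positivity) h1
    rw [Real.log_pow, Real.log_pow] at h2
    nlinarith
  -- the valuation: ord₂((−p)^l q^m − 1) = ord₂(−2^k) = k
  have hLHS : padicValRat 2 (((-(p : ℤ) : ℤ) : ℚ) ^ (l : ℤ) * ((q : ℤ) : ℚ) ^ (m : ℤ) - 1) = k := by
    push_cast
    rw [zpow_natCast, zpow_natCast, hl.neg_pow]
    have hcast : -(p : ℚ) ^ l * (q : ℚ) ^ m - 1 = -((2 : ℚ) ^ k) := by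
      have : (1 : ℚ) + (p : ℚ) ^ l * (q : ℚ) ^ m = 2 ^ k := by exact_mod_cast h
      linarith
    haveI : Fact (Nat.Prime 2) := ⟨Nat.prime_two⟩
    rw [hcast, padicValRat.neg, padicValRat.pow]
    have h2 : padicValRat 2 (2 : ℚ) = 1 := by
      have := padicValRat.self (p := 2) (by norm_num)
      exact_mod_cast this
    rw [h2]; ring
  have hv : (k : ℝ) ≤
      padicValRat 2 (((-(p : ℤ) : ℤ) : ℚ) ^ (l : ℤ) * ((q : ℤ) : ℚ) ^ (m : ℤ) - 1) := by
    rw [hLHS]; push_cast; exact le_rfl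
  exact twoadic_exponent_le hBL hp hq hp2 hq2 hpq (Or.inr rfl) (Or.inl rfl)
    (by exact_mod_cast hl0.ne') (by exact_mod_cast hm.ne') hk0 hv hs₁ hs₂

/-- **Shape F, known side.**  If `p ≠ q` are odd primes, `l, m ≥ 1` and `1 + p^l q^m = 2^k`, then
(granting `bugeaudLaurent1996_rat`) `k ≤ 50000 · log p · log q`. [folklore] -/
theorem shapeF_exponent_le (hBL : bugeaudLaurent1996_rat) {p q k l m : ℕ}
    (hp : p.Prime) (hq : q.Prime) (hp2 : p ≠ 2) (hq2 : q ≠ 2) (hpq : p ≠ q)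
    (hl : 0 < l) (hm : 0 < m) (h : 1 + p ^ l * q ^ m = 2 ^ k) :
    (k : ℝ) ≤ 50000 * Real.log p * Real.log q := by
  have hp3 : 3 ≤ p := by have := hp.two_le; omega
  rcases shapeF_not_both_even (hp.odd_of_ne_two hp2) (hq.odd_of_ne_two hq2) hp3 hl h with hlo | hmo
  · exact shapeF_exponent_le_of_odd hBL hp hq hp2 hq2 hpq hlo hm h
  · have h' : 1 + q ^ m * p ^ l = 2 ^ k := by rw [mul_comm]; exact h
    have := shapeF_exponent_le_of_odd hBL hq hp hq2 hp2 (Ne.symm hpq) hmo hl h'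
    linarith [this]

/-- Shape F, the bound for `c = 2^k` itself: `log c = k log 2 ≤ 50000 log 2 · log p · log q`.
[folklore] -/
theorem shapeF_log_c_le (hBL : bugeaudLaurent1996_rat) {p q k l m : ℕ}
    (hp : p.Prime) (hq : q.Prime) (hp2 : p ≠ 2) (hq2 : q ≠ 2) (hpq : p ≠ q)
    (hl : 0 < l) (hm : 0 < m) (h : 1 + p ^ l * q ^ m = 2 ^ k) :
    Real.log ((2 : ℝ) ^ k) ≤ 50000 * Real.log 2 * Real.log p * Real.log q := by
  rw [Real.log_pow]
  have := shapeF_exponent_le hBL hp hq hp2 hq2 hpq hl hm h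
  have hlog2 : 0 < Real.log 2 := Real.log_pos (by norm_num)
  nlinarith

end Summit.ABC.ABC.Theorems

end
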